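import Summits.KontsevichZagierPeriods.KontsevichZagierPeriods.Theorems.K2SymbolChainsFigureEightIsTwoSmythWindow
import Summits.KontsevichZagierPeriods.KontsevichZagierPeriods.Theorems.K2SymbolChainsJensenIsScissorsKLemma
import Summits.KontsevichZagierPeriods.KontsevichZagierPeriods.Theorems.K2SymbolChainsJensenIsScissorsBand
import Mathlib.Analysis.SpecialFunctions.ImproperIntegrals

/-!
# `FigureEightIsTwoSmyth`, post-Jensen chain III: odd part, even part and the doubling (helper)

Item stmt-KontsevichZagierPeriods-5203 of route K2SymbolChains. The window representation
`Y = [{−√3 < x < √3, 1 < u < 16/(1+x²)²}, (1 − x/R(x))/(2(1+x²)(1+s²)u)]` (chain II) splits by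
integrand additivity (rule 1b) into its even part
`E = [same domain, 1/(2(1+x²)(1+s²)u)]` and its odd part `O` (weight `−x/(2R(x)(1+x²)(1+s²))`,
`R` even). The odd part is a relation: split its base at `x = 0` (rule 1a; the slice `x = 0` is
null) and fold `x < 0` onto `x > 0` by `x ↦ −x` (rule 2), where the two integrands cancel
(`[σ, f] + [σ, −f] ∈ S`). The even part is half the Smyth band by the dilation (product) lemma of
the JensenIsScissors toolkit, `log V² ~ 2 log V` with `V = 4/(1+x²) ≥ 1` on the window:
`[E] − 2·[H] ∈ S`, `H = [{1 < u < 4/(1+x²)}, 1/(2(1+x²)(1+s²)u)]`, while the post-Jensen Smyth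
representation `R_B = [{1 < u < 4/(1+x²)}, 4/((1+x²)(1+s²)u)]` is `8·[H]`. Altogether

  `4·[Y] − [R_B] ∈ S`      (`four_window_sub_smyth_mem`).

The three auxiliary band representations `E`, `O`, `H` converge absolutely (bounded continuous
weight on a bounded window times `1/(1+s²)`), built with `exists_bandRep`.
[Kontsevich–Zagier 2001, §1.1–1.2, rules 1)–2)] [folklore]
-/

noncomputable section

open MeasureTheory Set
open Literature.NumberTheory.Transcendental Literature.ModelTheory.ExponentialFields
open Summit.KontsevichZagierPeriods.K2SymbolChains.JensenIsScissorsProof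

-- single-conjunct summit: Sub = Summit, so the namespace segment repeats by design (CONVENTIONS §2)
set_option linter.dupNamespace false

namespace Summit.KontsevichZagierPeriods.KontsevichZagierPeriods.Theorems

open Literature.NumberTheory.Transcendental.KZ

variable {S : AddSubgroup FormalRep}

/-! ### Generic bookkeeping: rational multiples of a representation -/

/-- A representation with the same domain and the integrand multiplied by a rational constant exists.
[Kontsevich–Zagier 2001, §1.2] [folklore] -/
theorem exists_constMulRep {N : ℕ} (r : IntegralRep N) (c : ℚ) :
    ∃ r' : IntegralRep N, r'.domain = r.domain ∧ r'.integrand = fun x => (c : ℝ) * r.integrand x :=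
  ⟨⟨r.domain, fun x => (c : ℝ) * r.integrand x, r.isSemialgebraic_domain,
    IsSemialgebraicFunOn.mul_holds (isSemialgebraicFunOn_ratCast r.isSemialgebraic_domain c)
      r.isSemialgebraicFunOn_integrand, r.integrableOn.const_mul _⟩, rfl, rfl⟩

/-- **`[n·f] − n·[f] ∈ S`**: a representation whose integrand is `n` times that of `r` on the common
domain differs from `n·[r]` by an element of `S` (integrand additivity, induction on `n`).
[Kontsevich–Zagier 2001, §1.2, rule 1)] [folklore] -/
theorem of_sub_nsmul_of_mem (hS : domainAddRel ∪ integrandAddRel ∪ changeOfVariablesRel ⊆ S) {N : ℕ}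
    (r : IntegralRep N) (n : ℕ) : ∀ r' : IntegralRep N, r'.domain = r.domain →
      EqOn r'.integrand (fun x => (n : ℝ) * r.integrand x) r.domain → of r' - n • of r ∈ S := by
  induction n with
  | zero =>
    intro r' hd hi
    simp only [zero_smul, sub_zero]
    exact of_mem_of_eqOn_zero hS r' fun x hx => by simpa using hi (hd ▸ hx)
  | succ n ih =>
    intro r' hd hi
    obtain ⟨rn, hnd, hni⟩ := exists_constMulRep r (n : ℚ)
    have h1 : of rn - n • of r ∈ S := ih rn hnd fun x _ => by simp [hni]
    have h2 : of r' - of rn - of r ∈ S :=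
      of_sub_of_sub_mem_of_add hS (by rw [hnd, hd]) (by rw [hd]) fun x hx => by
        rw [hi (hd ▸ hx), hni]
        simp only [Pi.add_apply, Rat.cast_natCast, Nat.cast_succ]
        ring
    have : of r' - (n + 1) • of r = (of r' - of rn - of r) + (of rn - n • of r) := by
      rw [add_smul, one_smul]; abel
    rw [this]
    exact S.add_mem h2 h1

/-! ### Integrability of product weights over the window -/

/-- A weight `k(x)/(1+s²)` with `k` continuous on `[−√3, √3]` is integrable on the window cylinder
`{b | −√3 < b 0 < √3} ⊆ ℝ²` (Fubini: `∫ ds/(1+s²) = π`). [folklore] -/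
theorem integrableOn_window_mul {k : ℝ → ℝ} (hk : ContinuousOn k (Icc (-Real.sqrt 3) (Real.sqrt 3))) :
    IntegrableOn (fun b : Fin 2 → ℝ => k (b 0) * (1 + b 1 ^ 2)⁻¹)
      {b : Fin 2 → ℝ | b 0 ∈ Ioo (-Real.sqrt 3) (Real.sqrt 3)} := by
  have hkI : IntegrableOn k (Ioo (-Real.sqrt 3) (Real.sqrt 3)) :=
    hk.integrableOn_Icc.mono_set Ioo_subset_Icc_self
  have h1 : IntegrableOn (fun x : Fin 1 → ℝ => k (x 0)) {x : Fin 1 → ℝ | x 0 ∈ Ioo (-Real.sqrt 3) (Real.sqrt 3)} :=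
    ((volume_preserving_funUnique (Fin 1) ℝ).integrableOn_comp_preimage
      (MeasurableEquiv.funUnique (Fin 1) ℝ).measurableEmbedding).2 hkI
  have h := integrableOn_cyl_mul h1 integrable_inv_one_add_sq
  exact h

/-! ### Semialgebraic atoms -/

/-- The even weight `1/(2(1+x²)(1+s²))` is `ℚ`-semialgebraic. [BCR 1998, §2.2] [folklore] -/
theorem isSemialgebraicFunOn_weightE {T : Set (Fin 2 → ℝ)} (hT : IsSemialgebraic ℚ T) :
    IsSemialgebraicFunOn ℚ T fun b => 1 / (2 * (1 + b 0 ^ 2) * (1 + b 1 ^ 2)) := by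
  refine (isSemialgebraicFunOn_aeval_div_aeval hT 1 (2 * (1 + MvPolynomial.X 0 ^ 2) * (1 + MvPolynomial.X 1 ^ 2))
    fun b _ => ?_).congr fun b _ => by simp
  have : (0 : ℝ) < 2 * (1 + b 0 ^ 2) * (1 + b 1 ^ 2) := by positivity
  simpa using this.ne'

/-- `x² < 3` on the window. [folklore] -/
theorem sq_lt_three_of_mem_window {x : ℝ} (hx : x ∈ Ioo (-Real.sqrt 3) (Real.sqrt 3)) : x ^ 2 < 3 := by
  have h : |x| < Real.sqrt 3 := abs_lt.2 hx
  have := (Real.lt_sqrt (abs_nonneg _)).1 h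
  rwa [sq_abs] at this

/-- The odd weight `−x/(2R(x)(1+x²)(1+s²))` is `ℚ`-semialgebraic on any `ℚ`-semialgebraic part of the
window cylinder. [BCR 1998, §2.2] [folklore] -/
theorem isSemialgebraicFunOn_weightO {T : Set (Fin 2 → ℝ)} (hT : IsSemialgebraic ℚ T)
    (hTw : T ⊆ {b : Fin 2 → ℝ | b 0 ∈ Ioo (-Real.sqrt 3) (Real.sqrt 3)}) :
    IsSemialgebraicFunOn ℚ T fun b => -(b 0) /
      (2 * Real.sqrt ((15 - b 0 ^ 2) / (1 + b 0 ^ 2)) * (1 + b 0 ^ 2) * (1 + b 1 ^ 2)) := by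
  have hR := isSemialgebraicFunOn_rootR hT
  have hp := (isSemialgebraicFunOn_aeval hT ((1 + MvPolynomial.X 0 ^ 2) * (1 + MvPolynomial.X 1 ^ 2))).congr
    (g := fun b : Fin 2 → ℝ => (1 + b 0 ^ 2) * (1 + b 1 ^ 2)) fun b _ => by simp
  have h2 : IsSemialgebraicFunOn ℚ T (fun _ => ((2 : ℚ) : ℝ)) := isSemialgebraicFunOn_ratCast hT 2
  have hden : IsSemialgebraicFunOn ℚ T (fun b => 2 * Real.sqrt ((15 - b 0 ^ 2) / (1 + b 0 ^ 2)) *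
      (1 + b 0 ^ 2) * (1 + b 1 ^ 2)) :=
    (IsSemialgebraicFunOn.mul_holds (IsSemialgebraicFunOn.mul_holds h2 hR) hp).congr fun b _ => by
      simp only [Pi.mul_apply]; push_cast; ring
  refine IsSemialgebraicFunOn.div (isSemialgebraicFunOn_apply hT 0).neg hden fun b hb => ?_
  have hx3 := sq_lt_three_of_mem_window (hTw hb)
  have hRp := rootR_pos (show b 0 ^ 2 < 15 by linarith)
  positivity

/-- The null slice `{b | b 0 = 0}` of `ℝ²`. [folklore] -/
theorem volume_fin_two_setOf_apply_zero_eq : volume {b : Fin 2 → ℝ | b 0 = 0} = 0 := by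
  rw [volume_pi]
  exact Measure.pi_hyperplane _ 0 0

/-! ### The odd part is a relation -/

/-- **The odd part vanishes.** A band representation over the window whose upper edge is even in `x`
and whose weight is the odd function `−x/(2R(x)(1+x²)(1+s²))` lies in `S`: split the base at
`x = 0` (rule 1a; the slice `x = 0` is null), carry `x < 0` onto `x > 0` by `x ↦ −x` (rule 2) and
cancel. [Kontsevich–Zagier 2001, §1.2, rules 1)–2)] [folklore] -/
theorem of_oddRep_mem (hS : domainAddRel ∪ integrandAddRel ∪ changeOfVariablesRel ⊆ S) (O : IntegralRep 3)
    (hOd : O.domain = {z : Fin 3 → ℝ | Fin.init z ∈ {b : Fin 2 → ℝ | b 0 ∈ Ioo (-Real.sqrt 3) (Real.sqrt 3)} ∧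
      1 < z (Fin.last 2) ∧ z (Fin.last 2) < 16 / (1 + (Fin.init z) 0 ^ 2) ^ 2})
    (hOi : O.integrand = fun z => -((Fin.init z) 0) /
      (2 * Real.sqrt ((15 - (Fin.init z) 0 ^ 2) / (1 + (Fin.init z) 0 ^ 2)) * (1 + (Fin.init z) 0 ^ 2) *
        (1 + (Fin.init z) 1 ^ 2)) / z (Fin.last 2)) :
    of O ∈ S := by
  set q : (Fin 2 → ℝ) → ℝ := fun b => 16 / (1 + b 0 ^ 2) ^ 2 with hq
  have hq_init : ∀ z : Fin 3 → ℝ, q (Fin.init z) = 16 / (1 + (Fin.init z) 0 ^ 2) ^ 2 := fun z => rfl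
  set P : Set (Fin 2 → ℝ) := {b | b 0 < (0 : ℝ)} with hP_def
  set Q : Set (Fin 2 → ℝ) := {b | (0 : ℝ) < b 0} with hQ_def
  have hP : IsSemialgebraic ℚ P := by simpa using isSemialgebraic_fin_two_lt 0
  have hQ : IsSemialgebraic ℚ Q := by simpa using isSemialgebraic_fin_two_gt 0
  have hs3 : (0 : ℝ) < Real.sqrt 3 := Real.sqrt_pos.2 (by norm_num)
  -- split at `x = 0`
  have s₁ := of_sub_restrict_base_mem hS O hP
  set O₁ := O.restrict (O.domain ∩ {z | Fin.init z ∈ P})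
    (O.isSemialgebraic_domain.inter (isSemialgebraic_cyl hP)) inter_subset_left with hO₁
  set O₂ := O.restrict (O.domain \ {z | Fin.init z ∈ P})
    (O.isSemialgebraic_domain.diff (isSemialgebraic_cyl hP)) sdiff_subset with hO₂
  have s₂ := of_sub_restrict_base_mem hS O₂ hQ
  set O₃ := O₂.restrict (O₂.domain ∩ {z | Fin.init z ∈ Q})
    (O₂.isSemialgebraic_domain.inter (isSemialgebraic_cyl hQ)) inter_subset_left with hO₃
  set O₄ := O₂.restrict (O₂.domain \ {z | Fin.init z ∈ Q})
    (O₂.isSemialgebraic_domain.diff (isSemialgebraic_cyl hQ)) sdiff_subset with hO₄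
  have hO₁d : O₁.domain = {z : Fin 3 → ℝ | Fin.init z ∈ {b : Fin 2 → ℝ | b 0 ∈ Ioo (-Real.sqrt 3) 0} ∧
      1 < z (Fin.last 2) ∧ z (Fin.last 2) < q (Fin.init z)} := by
    rw [hO₁, IntegralRep.domain_restrict, hOd]
    ext z
    simp only [mem_inter_iff, mem_setOf_eq, hP_def, mem_Ioo, hq_init]
    constructor
    · rintro ⟨⟨⟨h1, -⟩, hu, hq'⟩, h0⟩; exact ⟨⟨h1, h0⟩, hu, hq'⟩
    · rintro ⟨⟨h1, h0⟩, hu, hq'⟩; exact ⟨⟨⟨h1, h0.trans hs3⟩, hu, hq'⟩, h0⟩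
  have hO₃d : O₃.domain = {z : Fin 3 → ℝ | Fin.init z ∈ {b : Fin 2 → ℝ | b 0 ∈ Ioo 0 (Real.sqrt 3)} ∧
      1 < z (Fin.last 2) ∧ z (Fin.last 2) < q (Fin.init z)} := by
    rw [hO₃, IntegralRep.domain_restrict, hO₂, IntegralRep.domain_restrict, hOd]
    ext z
    simp only [mem_inter_iff, mem_sdiff, mem_setOf_eq, hP_def, hQ_def, mem_Ioo, hq_init, not_lt]
    constructor
    · rintro ⟨⟨⟨⟨-, h2⟩, hu, hq'⟩, -⟩, h0⟩; exact ⟨⟨h0, h2⟩, hu, hq'⟩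
    · rintro ⟨⟨h0, h2⟩, hu, hq'⟩; exact ⟨⟨⟨⟨by linarith, h2⟩, hu, hq'⟩, h0.le⟩, h0⟩
  -- the slice `x = 0` is null
  have e₀ : of O₄ ∈ S := by
    refine of_mem_of_base_null hS O₄ volume_fin_two_setOf_apply_zero_eq fun z hz => ?_
    rw [hO₄, IntegralRep.domain_restrict, hO₂, IntegralRep.domain_restrict] at hz
    simp only [mem_sdiff, mem_setOf_eq, hP_def, hQ_def, not_lt] at hz
    exact le_antisymm hz.2 hz.1.2
  -- fold `x < 0` onto `x > 0`
  have hI : IsSemialgebraic ℚ {b : Fin 2 → ℝ | b 0 ∈ Ioo (-Real.sqrt 3) 0} := by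
    have h := isSemialgebraic_window.inter hP
    convert h using 1
    ext b
    simp only [mem_setOf_eq, mem_Ioo, mem_inter_iff, hP_def]
    constructor
    · rintro ⟨h1, h0⟩; exact ⟨⟨h1, h0.trans hs3⟩, h0⟩
    · rintro ⟨⟨h1, -⟩, h0⟩; exact ⟨h1, h0⟩
  have hJ : IsSemialgebraic ℚ {b : Fin 2 → ℝ | b 0 ∈ Ioo 0 (Real.sqrt 3)} := by
    have h := isSemialgebraic_window.inter hQ
    convert h using 1
    ext b
    simp only [mem_setOf_eq, mem_Ioo, mem_inter_iff, hQ_def]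
    constructor
    · rintro ⟨h0, h2⟩; exact ⟨⟨by linarith, h2⟩, h0⟩
    · rintro ⟨⟨-, h2⟩, h0⟩; exact ⟨h0, h2⟩
  have hJw : {b : Fin 2 → ℝ | b 0 ∈ Ioo 0 (Real.sqrt 3)} ⊆ {b : Fin 2 → ℝ | b 0 ∈ Ioo (-Real.sqrt 3) (Real.sqrt 3)} :=
    fun b hb => ⟨by have := hb.1; linarith, hb.2⟩
  have hqJ : IsSemialgebraicFunOn ℚ {b : Fin 2 → ℝ | b 0 ∈ Ioo 0 (Real.sqrt 3)} q :=
    (isSemialgebraicFunOn_aeval_div_aeval hJ (MvPolynomial.C 16) ((1 + MvPolynomial.X 0 ^ 2) ^ 2) fun b _ => by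
      have : (0 : ℝ) < (1 + b 0 ^ 2) ^ 2 := by positivity
      simpa using this.ne').congr fun b _ => by simp [hq]
  have hc1 : IsSemialgebraicFunOn ℚ {b : Fin 2 → ℝ | b 0 ∈ Ioo 0 (Real.sqrt 3)} (fun _ => (1 : ℝ)) := by
    simpa using isSemialgebraicFunOn_ratCast hJ 1
  have hf' : IsSemialgebraicFunOn ℚ {z : Fin 3 → ℝ | Fin.init z ∈ {b : Fin 2 → ℝ | b 0 ∈ Ioo 0 (Real.sqrt 3)} ∧
      1 < z (Fin.last 2) ∧ z (Fin.last 2) < q (Fin.init z)}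
      (fun z => -(-((Fin.init z) 0) /
        (2 * Real.sqrt ((15 - (Fin.init z) 0 ^ 2) / (1 + (Fin.init z) 0 ^ 2)) * (1 + (Fin.init z) 0 ^ 2) *
          (1 + (Fin.init z) 1 ^ 2)) / z (Fin.last 2))) := by
    have hD := isSemialgebraic_oband hc1 hqJ
    exact (IsSemialgebraicFunOn.div ((isSemialgebraicFunOn_weightO hJ hJw).comp_init.mono (fun z hz => hz.1) hD)
      (isSemialgebraicFunOn_apply hD _) fun z hz => (one_pos.trans hz.2.1).ne').neg
  obtain ⟨O₁', hO₁'d, hO₁'i, e₁⟩ := exists_image_baseMap hS (φ := fun t : ℝ => -t) (φ' := fun _ : ℝ => (-1 : ℝ))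
    (I := Ioo (-Real.sqrt 3) 0) (J := Ioo 0 (Real.sqrt 3)) hI ((isSemialgebraicFunOn_apply hI 0).neg)
    (fun t _ => by simpa using hasDerivAt_neg t) (fun t _ t' _ h => neg_injective h) (by simp)
    (q := q) (q' := q) (fun b _ => by simp only [hq, Matrix.cons_val_zero, neg_sq]) O₁ hO₁d hf'
    (fun z hz => by
      rw [hO₁, IntegralRep.integrand_restrict, hOi]
      have hz' := hz
      rw [hO₁d] at hz'
      have hx3 : (Fin.init z) 0 ^ 2 < 3 := by nlinarith [hz'.1.1, hz'.1.2, Real.sq_sqrt (show (0:ℝ) ≤ 3 by norm_num)]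
      have hR := (rootR_pos (show (Fin.init z) 0 ^ 2 < 15 by linarith)).ne'
      simp only [Fin.init_snoc, Fin.snoc_last, Matrix.cons_val_zero, Matrix.cons_val_one, neg_sq,
        abs_neg, abs_one, mul_one]
      ring)
  -- cancellation on `x > 0`
  have e₂ : of O₃ + of O₁' ∈ S := by
    refine of_add_of_mem_of_eqOn_neg hS (by rw [hO₁'d, hO₃d]) fun z hz => ?_
    rw [hO₁'i, hO₃, IntegralRep.integrand_restrict, hO₂, IntegralRep.integrand_restrict, hOi]
    simp only [Pi.neg_apply]
  have : of O = (of O - of O₁ - of O₂) + (of O₂ - of O₃ - of O₄) + of O₄ + (of O₁ - of O₁') + (of O₃ + of O₁') := by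
    abel
  rw [this]
  exact S.add_mem (S.add_mem (S.add_mem (S.add_mem s₁ s₂) e₀) e₁) e₂

/-! ### The even part, the doubling, and the assembly -/

/-- **`4·[Y] − [R_B] ∈ S`.** For the window representation `Y` of chain II and the post-Jensen
Smyth representation `R_B = [{−√3 < x < √3, 1 < u < 4/(1+x²)}, 4/((1+x²)(1+s²)u)]`:
`Y = E + O` (rule 1b) with `[O] ∈ S` (`of_oddRep_mem`), `[E] − 2·[H] ∈ S` by the dilation lemma
`log V² ~ 2 log V`, `V = 4/(1+x²) ≥ 1` (`of_logUnfold_mul_sub_sub_mem`), and `[R_B] − 8·[H] ∈ S`.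
[Kontsevich–Zagier 2001, §1.1–1.2, rules 1)–2)] [folklore] -/
theorem four_window_sub_smyth_mem (hS : domainAddRel ∪ integrandAddRel ∪ changeOfVariablesRel ⊆ S)
    (Y RB : IntegralRep 3)
    (hYd : Y.domain = {z : Fin 3 → ℝ | Fin.init z ∈ {b : Fin 2 → ℝ | b 0 ∈ Ioo (-Real.sqrt 3) (Real.sqrt 3)} ∧
      1 < z (Fin.last 2) ∧ z (Fin.last 2) < 16 / (1 + (Fin.init z) 0 ^ 2) ^ 2})
    (hYi : Y.integrand = fun z => (1 - (Fin.init z) 0 / Real.sqrt ((15 - (Fin.init z) 0 ^ 2) / (1 + (Fin.init z) 0 ^ 2))) /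
        (2 * (1 + (Fin.init z) 0 ^ 2) * (1 + (Fin.init z) 1 ^ 2)) / z (Fin.last 2))
    (hRBd : RB.domain = {z : Fin 3 → ℝ | Fin.init z ∈ {b : Fin 2 → ℝ | b 0 ∈ Ioo (-Real.sqrt 3) (Real.sqrt 3)} ∧
      1 < z (Fin.last 2) ∧ z (Fin.last 2) < 4 / (1 + (Fin.init z) 0 ^ 2)})
    (hRBi : EqOn RB.integrand (fun z => 4 / ((1 + (Fin.init z) 0 ^ 2) * (1 + (Fin.init z) 1 ^ 2)) /
      z (Fin.last 2)) RB.domain) :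
    4 • of Y - of RB ∈ S := by
  set T : Set (Fin 2 → ℝ) := {b : Fin 2 → ℝ | b 0 ∈ Ioo (-Real.sqrt 3) (Real.sqrt 3)} with hT_def
  have hT : IsSemialgebraic ℚ T := isSemialgebraic_window
  set GE : (Fin 2 → ℝ) → ℝ := fun b => 1 / (2 * (1 + b 0 ^ 2) * (1 + b 1 ^ 2)) with hGE
  set GO : (Fin 2 → ℝ) → ℝ := fun b => -(b 0) /
      (2 * Real.sqrt ((15 - b 0 ^ 2) / (1 + b 0 ^ 2)) * (1 + b 0 ^ 2) * (1 + b 1 ^ 2)) with hGO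
  set V : (Fin 2 → ℝ) → ℝ := fun b => 4 / (1 + b 0 ^ 2) with hV
  have hGEs : IsSemialgebraicFunOn ℚ T GE := isSemialgebraicFunOn_weightE hT
  have hGOs : IsSemialgebraicFunOn ℚ T GO := isSemialgebraicFunOn_weightO hT subset_rfl
  have hVs : IsSemialgebraicFunOn ℚ T V :=
    (isSemialgebraicFunOn_aeval_div_aeval hT (MvPolynomial.C 4) (1 + MvPolynomial.X 0 ^ 2) fun b _ => by
      have : (0 : ℝ) < 1 + b 0 ^ 2 := by positivity
      simpa using this.ne').congr fun b _ => by simp [hV]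
  have hVVs : IsSemialgebraicFunOn ℚ T (fun b => V b * V b) := IsSemialgebraicFunOn.mul_holds hVs hVs
  have hc1 : IsSemialgebraicFunOn ℚ T (fun _ => (1 : ℝ)) := by simpa using isSemialgebraicFunOn_ratCast hT 1
  have hx3 : ∀ b ∈ T, b 0 ^ 2 < 3 := fun b hb => sq_lt_three_of_mem_window hb
  have hV1 : ∀ b ∈ T, 1 ≤ V b := fun b hb => by
    rw [hV, le_div_iff₀ (by positivity)]; linarith [hx3 b hb]
  have hV0 : ∀ b ∈ T, 0 < V b := fun b hb => one_pos.trans_le (hV1 b hb)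
  have hVV : ∀ b : Fin 2 → ℝ, V b * V b = 16 / (1 + b 0 ^ 2) ^ 2 := fun b => by
    rw [hV]; have : (1 + b 0 ^ 2 : ℝ) ≠ 0 := by positivity
    field_simp; norm_num
  -- integrability of the three auxiliary weights times `log` of the edges
  have hlog0 : ∀ G : (Fin 2 → ℝ) → ℝ, IntegrableOn (fun b => G b * Real.log ((fun _ : Fin 2 → ℝ => (1 : ℝ)) b)) T :=
    fun G => by simp
  have hne1 : ∀ x : ℝ, (1 + x ^ 2 : ℝ) ≠ 0 := fun x => by positivity
  have hne2 : ∀ x : ℝ, (2 * (1 + x ^ 2) : ℝ) ≠ 0 := fun x => by positivity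
  have hc1x : Continuous fun x : ℝ => (1 + x ^ 2 : ℝ) := continuous_const.add (continuous_pow 2)
  have hRc : ContinuousOn (fun x : ℝ => Real.sqrt ((15 - x ^ 2) / (1 + x ^ 2))) (Icc (-Real.sqrt 3) (Real.sqrt 3)) :=
    (((continuous_const.sub (continuous_pow 2)).div hc1x hne1).continuousOn).sqrt
  have hRne : ∀ x ∈ Icc (-Real.sqrt 3) (Real.sqrt 3), Real.sqrt ((15 - x ^ 2) / (1 + x ^ 2)) ≠ 0 := by
    intro x hx
    have habs : |x| ≤ Real.sqrt 3 := abs_le.2 ⟨hx.1, hx.2⟩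
    have hx3' : x ^ 2 ≤ 3 := by
      rw [← sq_abs, ← Real.sq_sqrt (show (0:ℝ) ≤ 3 by norm_num)]
      exact pow_le_pow_left₀ (abs_nonneg x) habs 2
    exact (rootR_pos (by linarith)).ne'
  have hlogc : ∀ n : ℕ, Continuous fun x : ℝ => Real.log ((4 / (1 + x ^ 2)) ^ n) := fun n => by
    refine Continuous.log ((continuous_const.div hc1x hne1).pow n) fun x => ?_
    have : (0 : ℝ) < (4 / (1 + x ^ 2)) ^ n := by positivity
    exact this.ne'
  have hintE : ∀ n : ℕ, IntegrableOn (fun b => GE b * Real.log (V b ^ n)) T := by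
    intro n
    have hk : ContinuousOn (fun x : ℝ => 1 / (2 * (1 + x ^ 2)) * Real.log ((4 / (1 + x ^ 2)) ^ n))
        (Icc (-Real.sqrt 3) (Real.sqrt 3)) :=
      ((continuous_const.div (continuous_const.mul hc1x) hne2).mul (hlogc n)).continuousOn
    refine (integrableOn_window_mul hk).congr_fun (fun b _ => ?_) (IsSemialgebraic.measurableSet_holds hT)
    simp only [hGE, hV]
    have h1 : (1 + b 1 ^ 2 : ℝ) ≠ 0 := by positivity
    have h0 : (1 + b 0 ^ 2 : ℝ) ≠ 0 := by positivity
    set L := Real.log ((4 / (1 + b 0 ^ 2)) ^ n) with hL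
    clear_value L
    field_simp
  have hintO : IntegrableOn (fun b => GO b * Real.log ((fun b => V b * V b) b)) T := by
    have hk : ContinuousOn (fun x : ℝ => -x / (2 * Real.sqrt ((15 - x ^ 2) / (1 + x ^ 2)) * (1 + x ^ 2)) *
        Real.log ((4 / (1 + x ^ 2)) ^ 2)) (Icc (-Real.sqrt 3) (Real.sqrt 3)) := by
      refine ContinuousOn.mul (continuousOn_id.neg.div ((continuousOn_const.mul hRc).mul
        (continuousOn_const.add (continuousOn_pow 2))) fun x hx => ?_) (hlogc 2).continuousOn
      have := hRne x hx
      positivity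
    refine (integrableOn_window_mul hk).congr_fun (fun b hb => ?_) (IsSemialgebraic.measurableSet_holds hT)
    simp only [hGO, hV]
    have h1 : (1 + b 1 ^ 2 : ℝ) ≠ 0 := by positivity
    have h0 : (1 + b 0 ^ 2 : ℝ) ≠ 0 := by positivity
    have hR := (rootR_pos (show b 0 ^ 2 < 15 by linarith [hx3 b hb])).ne'
    rw [show (4 / (1 + b 0 ^ 2) * (4 / (1 + b 0 ^ 2)) : ℝ) = (4 / (1 + b 0 ^ 2)) ^ 2 by ring]
    set L := Real.log ((4 / (1 + b 0 ^ 2)) ^ 2) with hL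
    clear_value L
    set R := Real.sqrt ((15 - b 0 ^ 2) / (1 + b 0 ^ 2)) with hRdef
    clear_value R
    field_simp
  -- the three auxiliary representations
  obtain ⟨E, hEd, hEi⟩ := exists_bandRep (a := fun _ => (1 : ℝ)) (b := fun b => V b * V b) hT hGEs hc1 hVVs
    (fun _ _ => one_pos) (fun b hb => by nlinarith [hV1 b hb]) (hlog0 GE)
    (by simpa [pow_two] using hintE 2)
  obtain ⟨O, hOd', hOi'⟩ := exists_bandRep (a := fun _ => (1 : ℝ)) (b := fun b => V b * V b) hT hGOs hc1 hVVs
    (fun _ _ => one_pos) (fun b hb => by nlinarith [hV1 b hb]) (hlog0 GO) hintO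
  obtain ⟨H, hHd, hHi⟩ := exists_bandRep (a := fun _ => (1 : ℝ)) (b := V) hT hGEs hc1 hVs
    (fun _ _ => one_pos) hV1 (hlog0 GE) (by simpa using hintE 1)
  -- `Y = E + O`
  have hEd' : E.domain = Y.domain := by
    rw [hEd, hYd]; ext z; simp only [mem_setOf_eq, hVV]
  have hOd'' : O.domain = Y.domain := by
    rw [hOd', hYd]; ext z; simp only [mem_setOf_eq, hVV]
  have e₁ : of Y - of E - of O ∈ S := by
    refine of_sub_of_sub_mem_of_add hS hEd' hOd'' fun z hz => ?_
    rw [hYi, hEi, hOi']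
    rw [hYd] at hz
    have hx : (Fin.init z) 0 ^ 2 < 3 := hx3 _ hz.1
    have hR := (rootR_pos (show (Fin.init z) 0 ^ 2 < 15 by linarith)).ne'
    have hu : z (Fin.last 2) ≠ 0 := (one_pos.trans hz.2.1).ne'
    have h0 : (1 + (Fin.init z) 0 ^ 2 : ℝ) ≠ 0 := by positivity
    have h1 : (1 + (Fin.init z) 1 ^ 2 : ℝ) ≠ 0 := by positivity
    simp only [Pi.add_apply, hGE, hGO]
    field_simp
    ring
  -- the odd part vanishes
  have e₂ : of O ∈ S := of_oddRep_mem hS O (by rw [hOd'']; exact hYd) (by rw [hOi'])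
  -- the doubling `[E] − [H] − [H] ∈ S`
  have hVd : ∀ b ∈ T, DifferentiableAt ℝ V b := fun b _ => by
    rw [hV]
    have h0 : (1 + b 0 ^ 2 : ℝ) ≠ 0 := by positivity
    fun_prop (disch := exact h0)
  have hbandE : ∀ (R : IntegralRep 3) (W : (Fin 2 → ℝ) → ℝ), (∀ b ∈ T, 1 ≤ W b) →
      R.domain = {z : Fin 3 → ℝ | Fin.init z ∈ T ∧ (fun _ : Fin 2 → ℝ => (1 : ℝ)) (Fin.init z) < z (Fin.last 2) ∧
        z (Fin.last 2) < W (Fin.init z)} → R.integrand = (fun z => GE (Fin.init z) / z (Fin.last 2)) →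
      R.domain = logUnfoldDomain T W ∧ EqOn R.integrand (logUnfoldIntegrand GE) R.domain := by
    intro R W hW1 hRd hRi
    refine ⟨by rw [hRd, logUnfoldDomain_eq_of_one_le hW1], fun z hz => ?_⟩
    rw [hRd] at hz
    rw [hRi, logUnfoldIntegrand, if_pos hz.2.1, one_mul]
  obtain ⟨hEd₂, hEi₂⟩ := hbandE E (fun b => V b * V b) (fun b hb => by nlinarith [hV1 b hb]) hEd hEi
  obtain ⟨hHd₂, hHi₂⟩ := hbandE H V hV1 hHd hHi
  have e₃ : of E - of H - of H ∈ S :=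
    of_logUnfold_mul_sub_sub_mem hS hT hVs hVs hV1 hV0 (fun b hb => by nlinarith [hV1 b hb]) hVd E H H
      hEd₂ hEi₂ hHd₂ hHi₂ hHd₂ hHi₂
  -- `[R_B] − 8·[H] ∈ S`
  have e₄ : of RB - 8 • of H ∈ S := by
    refine of_sub_nsmul_of_mem hS H 8 RB (by rw [hRBd, hHd]) fun z hz => ?_
    rw [hHd] at hz
    have hzRB : z ∈ RB.domain := by rw [hRBd]; exact hz
    rw [hRBi hzRB, hHi]
    simp only [hGE]
    have hu : z (Fin.last 2) ≠ 0 := (one_pos.trans hz.2.1).ne'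
    have h0 : (1 + (Fin.init z) 0 ^ 2 : ℝ) ≠ 0 := by positivity
    have h1 : (1 + (Fin.init z) 1 ^ 2 : ℝ) ≠ 0 := by positivity
    push_cast
    field_simp
    norm_num
  -- assemble
  have : 4 • of Y - of RB = 4 • (of Y - of E - of O) + 4 • of O + 4 • (of E - of H - of H) - (of RB - 8 • of H) := by
    simp only [smul_sub]
    abel
  rw [this]
  exact S.sub_mem (S.add_mem (S.add_mem (S.nsmul_mem e₁ 4) (S.nsmul_mem e₂ 4)) (S.nsmul_mem e₃ 4)) e₄

end Summit.KontsevichZagierPeriods.KontsevichZagierPeriods.Theorems
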